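import Summits.KontsevichZagierPeriods.KontsevichZagierPeriods.Theses.IsogenyCertificates

/-!
# `AlgebraicModuliRealPeriodCell` (stmt-KontsevichZagierPeriods-18265, route IsogenyCertificates) —
line `Sketch`, stub T: the interval-image lemma for REAL moduli

Port of the `ℚ`-line's `Theorems/IsogenyCertificatesXMapPeriodTransferStubIntervalImage.lean`
(moduli `A' B' : ℤ`) to real moduli `α' β' : ℝ` (pure real analysis; no algebraicity is needed).
A continuous strictly monotone (or antitone) function `φ` on an open interval `C = (p, ∞)` or
`C = (p, q)`, with values in `{P' > 0}` (`P'(y) = y³ + α'y + β'`) and whose one-sided end limits are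
each either a root of `P'` or infinite in absolute value, maps `C` onto `(u, ∞)` or onto `(u, v)`
with `u < v` roots of `P'`. The end towards which `φ` decreases must have a finite limit because
`{P' > 0}` is bounded below; the image is order-connected (a continuous image of an interval), does
not contain its end values (strictness) and approaches them (the limits).

The core is the filter-level lemma `intervalImage_core` (two abstract "end filters" approaching the
infimum and the supremum side of an order-connected set); `stub_intervalImage` instantiates it in the
four cases increasing/decreasing × bounded/unbounded cell.

References: M. Kontsevich, D. Zagier, *Periods* (2001), §1.2 (the rule-(2) pieces this serves).
-/

noncomputable section

open Set Filter Topology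

namespace Summit.KontsevichZagierPeriods.IsogenyCertificates.AlgRealPeriodCell.TransferIntervalImage

/-- `{P' > 0}` is bounded below by `-(1 + |α'| + |β'|)`. [folklore] -/
theorem intervalImage_lower_bound (α' β' : ℝ) {y : ℝ} (hy : 0 < y ^ 3 + α' * y + β') :
    -(1 + |α'| + |β'|) < y := by
  -- adapted from `cubic_pos_of_large_le` (…TransferCellsBasic), with `y = -z`
  by_contra h
  have hA : -|α'| ≤ α' := neg_abs_le _
  have hB : β' ≤ |β'| := le_abs_self _
  have h0A : 0 ≤ |α'| := abs_nonneg _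
  have h0B : 0 ≤ |β'| := abs_nonneg _
  obtain ⟨z, rfl⟩ : ∃ z : ℝ, y = -z := ⟨-y, (neg_neg y).symm⟩
  have hz : 1 + |α'| + |β'| ≤ z := by linarith [not_lt.1 h]
  have hz1 : 1 ≤ z := by linarith
  have hz0 : 0 ≤ z := by linarith
  nlinarith [mul_le_mul_of_nonneg_left hA hz0, sq_nonneg z, mul_le_mul_of_nonneg_left hz1 hz0,
    mul_le_mul_of_nonneg_left hz hz0, mul_nonneg hz0 h0B]

/-- **Core of the interval-image lemma.** Let `I ⊆ (m, ∞)` be order-connected and non-empty, and let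
`F₁`, `F₂` be non-trivial filters along which `g` takes values in `I` below, resp. above, any given
point of `I`. If along each of them `g` tends to a root of `P'` or `|g| → ∞`, then
`I = (u, ∞)` or `I = (u, v)` with `u < v` roots of `P'`. [folklore] -/
theorem intervalImage_core (α' β' : ℝ) (g : ℝ → ℝ) (I : Set ℝ) (m : ℝ) (F₁ F₂ : Filter ℝ)
    [F₁.NeBot] [F₂.NeBot] (hI : I.OrdConnected) (hne : I.Nonempty) (hIm : I ⊆ Ioi m)
    (hlo : ∀ y ∈ I, ∀ᶠ t in F₁, g t ∈ I ∧ g t < y)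
    (hhi : ∀ y ∈ I, ∀ᶠ t in F₂, g t ∈ I ∧ y < g t)
    (hlim₁ : (∃ ℓ : ℝ, ℓ ^ 3 + α' * ℓ + β' = 0 ∧ Tendsto g F₁ (𝓝 ℓ)) ∨
      Tendsto (fun x => |g x|) F₁ atTop)
    (hlim₂ : (∃ ℓ : ℝ, ℓ ^ 3 + α' * ℓ + β' = 0 ∧ Tendsto g F₂ (𝓝 ℓ)) ∨
      Tendsto (fun x => |g x|) F₂ atTop) :
    ∃ u : ℝ, u ^ 3 + α' * u + β' = 0 ∧
      (I = Ioi u ∨ ∃ v : ℝ, v ^ 3 + α' * v + β' = 0 ∧ u < v ∧ I = Ioo u v) := by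
  obtain ⟨y₀, hy₀⟩ := hne
  -- the infimum side has a finite limit (the image is bounded below)
  have hfin : ∃ u : ℝ, u ^ 3 + α' * u + β' = 0 ∧ Tendsto g F₁ (𝓝 u) := by
    rcases hlim₁ with h | h
    · exact h
    · exfalso
      obtain ⟨t, ⟨htI, hty⟩, hgt⟩ := ((hlo y₀ hy₀).and (h.eventually_gt_atTop (max |m| |y₀|))).exists
      have hm : m < g t := hIm htI
      have : |g t| ≤ max |m| |y₀| := abs_le_max_abs_abs hm.le hty.le
      linarith
  obtain ⟨u, hu, hu_t⟩ := hfin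
  have hle : ∀ y ∈ I, u ≤ y := fun y hy =>
    le_of_tendsto hu_t ((hlo y hy).mono fun t ht => ht.2.le)
  have hlt : ∀ y ∈ I, u < y := fun y hy => by
    obtain ⟨t, htI, hty⟩ := (hlo y hy).exists
    exact (hle _ htI).trans_lt hty
  have hbelow : ∀ z, u < z → ∃ a ∈ I, a < z := fun z hz => by
    have h1 : ∀ᶠ t in F₁, g t < z := hu_t (Iio_mem_nhds hz)
    obtain ⟨t, ⟨htI, -⟩, htz⟩ := ((hlo y₀ hy₀).and h1).exists
    exact ⟨g t, htI, htz⟩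
  refine ⟨u, hu, ?_⟩
  rcases hlim₂ with ⟨v, hv, hv_t⟩ | htop
  · right
    have hge : ∀ y ∈ I, y ≤ v := fun y hy =>
      ge_of_tendsto hv_t ((hhi y hy).mono fun t ht => ht.2.le)
    have hgt : ∀ y ∈ I, y < v := fun y hy => by
      obtain ⟨t, htI, hty⟩ := (hhi y hy).exists
      exact hty.trans_le (hge _ htI)
    have habove : ∀ z, z < v → ∃ b ∈ I, z < b := fun z hz => by
      have h1 : ∀ᶠ t in F₂, z < g t := hv_t (Ioi_mem_nhds hz)
      obtain ⟨t, ⟨htI, -⟩, htz⟩ := ((hhi y₀ hy₀).and h1).exists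
      exact ⟨g t, htI, htz⟩
    refine ⟨v, hv, (hlt y₀ hy₀).trans (hgt y₀ hy₀), ?_⟩
    ext z
    constructor
    · intro hz
      exact ⟨hlt z hz, hgt z hz⟩
    · rintro ⟨h1, h2⟩
      obtain ⟨a, haI, haz⟩ := hbelow z h1
      obtain ⟨b, hbI, hzb⟩ := habove z h2
      exact hI.out haI hbI ⟨haz.le, hzb.le⟩
  · left
    have habove : ∀ z, ∃ b ∈ I, z < b := fun z => by
      obtain ⟨t, ⟨htI, -⟩, hgt⟩ :=
        ((hhi y₀ hy₀).and (htop.eventually_gt_atTop (max |m| |z|))).exists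
      refine ⟨g t, htI, ?_⟩
      by_contra hzle
      have hm : m < g t := hIm htI
      have : |g t| ≤ max |m| |z| := abs_le_max_abs_abs hm.le (not_lt.1 hzle)
      linarith
    ext z
    constructor
    · intro hz
      exact hlt z hz
    · intro hz
      obtain ⟨a, haI, haz⟩ := hbelow z hz
      obtain ⟨b, hbI, hzb⟩ := habove z
      exact hI.out haI hbI ⟨haz.le, hzb.le⟩

/-- **Port of the registered stub `stub_intervalImage`** (E3, pure real analysis) of the
`ℚ`-line to real moduli. A continuous strictly monotone function on an open interval `C` bounded
below, with values in `{P' > 0}` and one-sided end limits each a root of `P'` or infinite in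
absolute value, maps `C` onto `(u, ∞)` or `(u, v)` with `u < v` roots of `P'`. [folklore] -/
theorem stub_intervalImage : ∀ (α' β' : ℝ) (φ : ℝ → ℝ) (C : Set ℝ) (p : ℝ), (C = Set.Ioi p ∨ ∃ q : ℝ, p < q ∧ C = Set.Ioo p q) → ContinuousOn φ C → (StrictMonoOn φ C ∨ StrictAntiOn φ C) → φ '' C ⊆ {y : ℝ | 0 < y ^ 3 + α' * y + β'} → ((∃ ℓ : ℝ, ℓ ^ 3 + α' * ℓ + β' = 0 ∧ Filter.Tendsto φ (nhdsWithin p (Set.Ioi p)) (nhds ℓ)) ∨ Filter.Tendsto (fun x => |φ x|) (nhdsWithin p (Set.Ioi p)) Filter.atTop) → (∀ q : ℝ, C = Set.Ioo p q → (∃ ℓ : ℝ, ℓ ^ 3 + α' * ℓ + β' = 0 ∧ Filter.Tendsto φ (nhdsWithin q (Set.Iio q)) (nhds ℓ)) ∨ Filter.Tendsto (fun x => |φ x|) (nhdsWithin q (Set.Iio q)) Filter.atTop) → (C = Set.Ioi p → (∃ ℓ : ℝ, ℓ ^ 3 + α' * ℓ + β' = 0 ∧ Filter.Tendsto φ Filter.atTop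 (nhds ℓ)) ∨ Filter.Tendsto (fun x => |φ x|) Filter.atTop Filter.atTop) → ∃ u : ℝ, u ^ 3 + α' * u + β' = 0 ∧ (φ '' C = Set.Ioi u ∨ ∃ v : ℝ, v ^ 3 + α' * v + β' = 0 ∧ u < v ∧ φ '' C = Set.Ioo u v) := by
  intro α' β' φ C p hC hcont hmono hsub hleft hright hinf
  -- generalities about the image
  set I := φ '' C with hIdef
  have hIm : I ⊆ Ioi (-(1 + |α'| + |β'|)) := fun y hy =>
    intervalImage_lower_bound α' β' (hsub hy)
  have hCpre : IsPreconnected C := by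
    rcases hC with rfl | ⟨q, _, rfl⟩
    · exact isPreconnected_Ioi
    · exact isPreconnected_Ioo
  have hIord : I.OrdConnected := isPreconnected_iff_ordConnected.1 (hCpre.image φ hcont)
  have hpC : ∀ x ∈ C, p < x := fun x hx => by
    rcases hC with rfl | ⟨q, _, rfl⟩
    · exact hx
    · exact hx.1
  have hCne : C.Nonempty := by
    rcases hC with rfl | ⟨q, hpq, rfl⟩
    · exact ⟨p + 1, by simp⟩
    · exact ⟨(p + q) / 2, by constructor <;> linarith⟩
  have hIne : I.Nonempty := hCne.image φ
  -- the left end filter `𝓝[>] p` enters `C` below any point of `C`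
  have hCleft : ∀ x ∈ C, ∀ᶠ t in 𝓝[>] p, t ∈ C ∧ t < x := fun x hx => by
    have hpx : p < x := hpC x hx
    have hsubC : Ioo p x ⊆ C := by
      rcases hC with rfl | ⟨q, _, rfl⟩
      · exact fun t ht => ht.1
      · exact fun t ht => ⟨ht.1, ht.2.trans hx.2⟩
    filter_upwards [Ioo_mem_nhdsGT hpx] with t ht
    exact ⟨hsubC ht, ht.2⟩
  rcases hC with rfl | ⟨q, hpq, rfl⟩
  · -- unbounded cell `(p, ∞)`: right end filter `atTop`
    have hCright : ∀ x ∈ Ioi p, ∀ᶠ t in atTop, t ∈ Ioi p ∧ x < t := fun x hx => by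
      filter_upwards [eventually_gt_atTop x] with t ht
      exact ⟨lt_trans hx ht, ht⟩
    have hinf' := hinf rfl
    rcases hmono with hm | hm
    · refine intervalImage_core α' β' φ I _ (𝓝[>] p) atTop hIord hIne hIm ?_ ?_ hleft hinf'
      · rintro _ ⟨x, hx, rfl⟩
        exact (hCleft x hx).mono fun t ht => ⟨mem_image_of_mem φ ht.1, hm ht.1 hx ht.2⟩
      · rintro _ ⟨x, hx, rfl⟩
        exact (hCright x hx).mono fun t ht => ⟨mem_image_of_mem φ ht.1, hm hx ht.1 ht.2⟩
    · refine intervalImage_core α' β' φ I _ atTop (𝓝[>] p) hIord hIne hIm ?_ ?_ hinf' hleft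
      · rintro _ ⟨x, hx, rfl⟩
        exact (hCright x hx).mono fun t ht => ⟨mem_image_of_mem φ ht.1, hm hx ht.1 ht.2⟩
      · rintro _ ⟨x, hx, rfl⟩
        exact (hCleft x hx).mono fun t ht => ⟨mem_image_of_mem φ ht.1, hm ht.1 hx ht.2⟩
  · -- bounded cell `(p, q)`: right end filter `𝓝[<] q`
    have hCright : ∀ x ∈ Ioo p q, ∀ᶠ t in 𝓝[<] q, t ∈ Ioo p q ∧ x < t := fun x hx => by
      filter_upwards [Ioo_mem_nhdsLT hx.2] with t ht
      exact ⟨⟨hx.1.trans ht.1, ht.2⟩, ht.1⟩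
    have hright' := hright q rfl
    rcases hmono with hm | hm
    · refine intervalImage_core α' β' φ I _ (𝓝[>] p) (𝓝[<] q) hIord hIne hIm ?_ ?_ hleft hright'
      · rintro _ ⟨x, hx, rfl⟩
        exact (hCleft x hx).mono fun t ht => ⟨mem_image_of_mem φ ht.1, hm ht.1 hx ht.2⟩
      · rintro _ ⟨x, hx, rfl⟩
        exact (hCright x hx).mono fun t ht => ⟨mem_image_of_mem φ ht.1, hm hx ht.1 ht.2⟩
    · refine intervalImage_core α' β' φ I _ (𝓝[<] q) (𝓝[>] p) hIord hIne hIm ?_ ?_ hright' hleft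
      · rintro _ ⟨x, hx, rfl⟩
        exact (hCright x hx).mono fun t ht => ⟨mem_image_of_mem φ ht.1, hm hx ht.1 ht.2⟩
      · rintro _ ⟨x, hx, rfl⟩
        exact (hCleft x hx).mono fun t ht => ⟨mem_image_of_mem φ ht.1, hm ht.1 hx ht.2⟩

end Summit.KontsevichZagierPeriods.IsogenyCertificates.AlgRealPeriodCell.TransferIntervalImage

end
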